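import Summits.QuantumFields.BalabanUV.Beta.GAN24.SigmaPairSlotMomentsExit
import Summits.QuantumFields.BalabanUV.Beta.GAN24.RotatedVertexEndExitValue

/-!
# `BalabanUV.Beta.GAN24.SigmaPairSlotMomentsExitSame` — binder row G-an2-4 ∕ (CONV-C), the (S) row of RULING R-gan24p1-g27-1 PART B (viii), the exit⊗exit σ-pair,
# SAME DIRECTION `α = β`: **THE PROFILE IS IDENTICALLY ZERO AT EVERY LEVEL `k ≥ 0`, ANY IN-BLOCK ROOT, ALL `cE cVH cΛ` — so (M0) ∧ (Π) hold trivially there; with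
# `SigmaPairSlotMomentsExit` §4 the WHOLE exit⊗exit block `{exit_α ⊗ exit_β : α, β}` of class 𝒞 is closed at level 0 with no displayed hypothesis**
# (G-an2-4 formalisation swarm → CRUX TEAM (2), seat `b2b-balaban-gan24-formalise-leaf-02`, gen 59, INTENT 3)

NOT IN PRINT; OUR BOOKKEEPING ([folklore] instantiation BY NAME: `k = 0` — MY g58 PART 3 `ExitChargeParityBase.tsum_exitWt_srecAt_zero_same` at `M = 1` ⨾ MY g57 PART D
`SrecChargeLamDropsAllLevels.tsum_prod_exitWt_srecAt_eq_spureRecAt` (the Λ-piece carries no exit⊗exit charge); `k = j+1` — road-P2 g42 `ChargeTowerSameDirection.tsum_exitCharge_same_eq_zero`;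
the multiplier table at every level — road-P2 g43 `RotatedVertexEndExitValue.tsum_prod_exit_M1At` (leaf-06 FILE F §1 at `k = 0`); 0 `def`, 0 cited fact, 0 `def … : Prop`, 0 sorry).
HONEST FRAMING (cell contract, verbatim): «discharging `BetaPertH` makes Bałaban's UV stability UNCONDITIONAL — a real constructive-QFT result; it is NOT the continuum limit and NOT
the Clay problem.»  HONEST DEPENDENCY (verbatim): «continuum YM on T⁴ ⇐ BetaPertH ∧ nine spine estimates (0/9 proved); BetaPertH ⇐ (D1) ∧ (D4) ∧ CAP+tail; G-an2-4 gates asym, D1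
and NE2/3/4.»
* §1 `tsum_exitWt_same_spureRecAt_zero` (level 0, any in-block root: the same-direction exit⊗exit charge function of `S₀` vanishes at every slot),
  **`tsum_exitWt_same_spureRecAt_level`** (EVERY level `k`: `k = 0` by §1, `k = j+1` by road-P2's tower).
* §2 **`profiles_sigmaPair_exit_same_eq_zero_level`** — with the BASE-POINT profile `Vα` and leaf-06's (γ) profile `Qc` bound by their defining equations at the channel
  `(inl α, inl α)` (any in-block root, all `cE cVH cΛ`, every `k y ν`): `∀ y′, Vα y′ = 0 ∧ Qc y′ = 0`; hence **`moments_sigmaPair_exit_same_level`**: the σ-pair's profile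
  `Z_k = Vα − ½·(stepScale_k·Lc^{d+1})⁻¹·Qc` has `Σ' Z_k = 0 ∧ ∀ λ, Σ' (y′ − y)_λ·Z_k(y′) = 0` — no parity, no pin, no (W-γ) needed in the same-direction channel.
READING.  `SigmaPairSlotMomentsExit.moments_sigmaPair_exit_levelZero` (`α ≠ β`, centred root, `Lc` odd, pin `cE = Lc^{d+1}`) + §2 (`α = β`, unconditional) = the (S) row at level 0
for every exit⊗exit channel of the σ-pair.  Asserts NO value of Bałaban's tables; NOTHING of (W-γ)_{k≥1} ∕ plain⊗exit ∕ (Q-R) ∕ (DL) ∕ (LT) ∕ «T2Shape» ∕ (hW, hWall); NEVER «G-an2-4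
closed» as (CONV-C); NOT D1, NOT `BetaPertH`, NOT continuum, NOT Clay.  2026-08-22; no existing file touched.
-/

noncomputable section

open Finset
open scoped BigOperators
open Literature.MathematicalPhysics.QuantumFieldTheory
open Literature.MathematicalPhysics.QuantumFieldTheory.Balaban1983to89
open Literature.MathematicalPhysics.QuantumFieldTheory.Balaban1983to89.Beta
open ExpKernelCalculus (Site MKer comp)
open AffineAveraging (box toSite)
open AveragingContours (blk)
open OneStepResolventKernel (Fib)
open OneStepKernelFamily (KInvStep colH)
open SecondOrderResponse (colM dM)
open Summit.QuantumFields.BalabanUV.Beta.BorderedHessian (stepScale)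
open Summit.QuantumFields.BalabanUV.Beta.AxialDressingRooted (coDressKBmAt one_le_of_neZero)
open Summit.QuantumFields.BalabanUV.Beta.SpineRooted (SpureRecAt M1At)
open Summit.QuantumFields.BalabanUV.Beta.KernelWardRelative (gaugeWt)
open Summit.QuantumFields.BalabanUV.Beta.GAN24.SrecChargeLamDropsAllLevels (tsum_prod_exitWt_srecAt_eq_spureRecAt)
open Summit.QuantumFields.BalabanUV.Beta.GAN24.ExitChargeParityBase (tsum_exitWt_srecAt_zero_same)
open Summit.QuantumFields.BalabanUV.Beta.GAN24.ChargeTowerSameDirection (tsum_exitCharge_same_eq_zero)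
open Summit.QuantumFields.BalabanUV.Beta.GAN24.RotatedVertexEndExitValue (tsum_prod_exit_M1At)

namespace Summit.QuantumFields.BalabanUV.Beta.GAN24.SigmaPairSlotMomentsExitSame

variable {d : ℕ} {Lc : ℕ} [NeZero Lc] {r : Fin (d + 1) → ℕ}

/-! ## §1 The same-direction exit⊗exit charge function of `S_k` vanishes at every level -/

/-- NOT IN PRINT; OUR BOOKKEEPING.  **LEVEL 0**: for any in-block root, all `cE cVH cΛ`, every slot `(κ, u)` and direction `α`,
`Σ'_{(x,z)} 𝟙^{exit}_α(x)·𝟙^{exit}_α(z)·S₀ κ u x z (inl α)(inl α) = 0` — MY g58 PART 3 `tsum_exitWt_srecAt_zero_same` at `M = 1` (the inner period-`1` indicator is `1`) for the FULL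
member `SrecAt … 0`, moved to the pure member by MY g57 PART D (the Λ-piece carries no exit⊗exit charge). -/
theorem tsum_exitWt_same_spureRecAt_zero (hr : r ∈ box (d + 1) Lc) (cE cVH cΛ : ℝ) (α κ : Fin (d + 1)) (u : Site (d + 1)) :
    ∑' xz : Site (d + 1) × Site (d + 1),
            ((if xz.1 α % (Lc : ℤ) = (Lc : ℤ) - 1 then (1 : ℝ) else 0) * (if xz.2 α % (Lc : ℤ) = (Lc : ℤ) - 1 then (1 : ℝ) else 0))
              * SpureRecAt d Lc (toSite r) cE cVH cΛ 0 κ u xz.1 xz.2 (Sum.inl α) (Sum.inl α) = 0 := by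
  have hLc : 1 ≤ Lc := one_le_of_neZero Lc
  -- PART D: pure ↔ full member under the plain exit weights (`f₁ = f₂ ≡ 1`)
  have hD := tsum_prod_exitWt_srecAt_eq_spureRecAt hLc hr cE cVH cΛ 0 (f₁ := fun _ : ℤ => (1 : ℝ)) (f₂ := fun _ : ℤ => (1 : ℝ)) (B₁ := 1) (B₂ := 1)
    (fun _ => by rw [abs_one]) (fun _ => by rw [abs_one]) κ u α α
  beta_reduce at hD
  rw [← hD]
  -- PART 3 at `M = 1`: the nested period-`Lc·1` weight is the plain exit weight
  have h3 := tsum_exitWt_srecAt_zero_same hr cE cVH cΛ α (M := 1) le_rfl κ u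
  simp only [Nat.cast_one, Int.emod_one, sub_self, if_true] at h3
  exact h3

/-- NOT IN PRINT; OUR BOOKKEEPING.  **EVERY LEVEL `k`**: the same-direction exit⊗exit charge function of `S_k` vanishes at every slot (`k = 0`: §1; `k = j+1`: road-P2 g42
`ChargeTowerSameDirection.tsum_exitCharge_same_eq_zero`). -/
theorem tsum_exitWt_same_spureRecAt_level (hr : r ∈ box (d + 1) Lc) (cE cVH cΛ : ℝ) (α : Fin (d + 1)) :
    ∀ (k : ℕ) (κ : Fin (d + 1)) (u : Site (d + 1)),
      ∑' xz : Site (d + 1) × Site (d + 1),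
            ((if xz.1 α % (Lc : ℤ) = (Lc : ℤ) - 1 then (1 : ℝ) else 0) * (if xz.2 α % (Lc : ℤ) = (Lc : ℤ) - 1 then (1 : ℝ) else 0))
              * SpureRecAt d Lc (toSite r) cE cVH cΛ k κ u xz.1 xz.2 (Sum.inl α) (Sum.inl α) = 0
  | 0, κ, u => tsum_exitWt_same_spureRecAt_zero hr cE cVH cΛ α κ u
  | j + 1, κ, u => tsum_exitCharge_same_eq_zero hr cE cVH cΛ α j κ u

/-! ## §2 Hence both profiles of the σ-pair vanish, and (M0) ∧ (Π) hold trivially -/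

/-- NOT IN PRINT; OUR BOOKKEEPING.  **SAME DIRECTION: THE (α) BASE-POINT PROFILE AND THE (γ) PROFILE ARE IDENTICALLY ZERO** (any in-block root, all `cE cVH cΛ`, every level `k`,
label `y`, slot direction `ν`, direction `α`; `Vα`, `Qc` bound by their defining equations at the channel `(inl α, inl α)`): both table charges vanish (§1 and road-P2 g43
`tsum_prod_exit_M1At`), so every term of either profile carries a factor `0`. -/
theorem profiles_sigmaPair_exit_same_eq_zero_level (hr : r ∈ box (d + 1) Lc) (cE cVH cΛ : ℝ) (k : ℕ) (y : Site (d + 1)) (ν α : Fin (d + 1))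
    {Vα Qc : Site (d + 1) → ℝ}
    (hVα : ∀ y' : Site (d + 1), Vα y' =
        (1 / 2 : ℝ) *
          ((∑ κ : Fin (d + 1), ∑' u : Site (d + 1),
              colH (coDressKBmAt (toSite r) Lc (KInvStep (d := d) Lc k)) Lc ν y' κ u
                * ((if y' = y then (1 / 2 : ℝ) else 0) - (if blk Lc u = y then (1 / 2 : ℝ) else 0))
                * ∑' xz : Site (d + 1) × Site (d + 1),
                    ((if xz.1 α % (Lc : ℤ) = (Lc : ℤ) - 1 then (1 : ℝ) else 0) * (if xz.2 α % (Lc : ℤ) = (Lc : ℤ) - 1 then (1 : ℝ) else 0))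
                      * SpureRecAt d Lc (toSite r) cE cVH cΛ k κ u xz.1 xz.2 (Sum.inl α) (Sum.inl α))
            + ∑ ρ' : Fin (d + 1), ∑' w : Site (d + 1),
              colM (coDressKBmAt (toSite r) Lc (KInvStep (d := d) Lc k)) Lc ν y' ρ' w
                * ((if y' = y then (1 / 2 : ℝ) else 0) - (if w = y then (1 / 2 : ℝ) else 0))
                * ∑' xz : Site (d + 1) × Site (d + 1),
                    ((if xz.1 α % (Lc : ℤ) = (Lc : ℤ) - 1 then (1 : ℝ) else 0) * (if xz.2 α % (Lc : ℤ) = (Lc : ℤ) - 1 then (1 : ℝ) else 0))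
                      * M1At d Lc (toSite r) cΛ k ρ' w xz.1 xz.2 (Sum.inl α) (Sum.inl α)))
    (hQc : ∀ y' : Site (d + 1), Qc y' =
        (∑ κ : Fin (d + 1), ∑' u : Site (d + 1),
            (∑' x₂, ∑ κ₂, comp (coDressKBmAt (toSite r) Lc (KInvStep (d := d) Lc k))
                (dM (coDressKBmAt (toSite r) Lc (KInvStep (d := d) Lc k)) Lc (SpureRecAt d Lc (toSite r) cE cVH cΛ k) (M1At d Lc (toSite r) cΛ k) ν y')
                u x₂ (Sum.inl κ) (Sum.inl κ₂) * gaugeWt Lc y κ₂ x₂)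
              * ∑' xz : Site (d + 1) × Site (d + 1),
                  ((if xz.1 α % (Lc : ℤ) = (Lc : ℤ) - 1 then (1 : ℝ) else 0) * (if xz.2 α % (Lc : ℤ) = (Lc : ℤ) - 1 then (1 : ℝ) else 0))
                    * SpureRecAt d Lc (toSite r) cE cVH cΛ k κ u xz.1 xz.2 (Sum.inl α) (Sum.inl α)
          + ∑ ρ' : Fin (d + 1), ∑' w : Site (d + 1),
            (∑' x₂, ∑ κ₂, comp (coDressKBmAt (toSite r) Lc (KInvStep (d := d) Lc k))
                (dM (coDressKBmAt (toSite r) Lc (KInvStep (d := d) Lc k)) Lc (SpureRecAt d Lc (toSite r) cE cVH cΛ k) (M1At d Lc (toSite r) cΛ k) ν y')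
                ((Lc : ℤ) • w) x₂ (Sum.inr ρ') (Sum.inl κ₂) * gaugeWt Lc y κ₂ x₂)
              * ∑' xz : Site (d + 1) × Site (d + 1),
                  ((if xz.1 α % (Lc : ℤ) = (Lc : ℤ) - 1 then (1 : ℝ) else 0) * (if xz.2 α % (Lc : ℤ) = (Lc : ℤ) - 1 then (1 : ℝ) else 0))
                    * M1At d Lc (toSite r) cΛ k ρ' w xz.1 xz.2 (Sum.inl α) (Sum.inl α))) :
    ∀ y' : Site (d + 1), Vα y' = 0 ∧ Qc y' = 0 := by
  intro y'
  have hS := tsum_exitWt_same_spureRecAt_level hr cE cVH cΛ α k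
  have hM := tsum_prod_exit_M1At hr cΛ k α α
  refine ⟨?_, ?_⟩
  · rw [hVα y']
    simp only [hS, hM, mul_zero, tsum_zero, Finset.sum_const_zero, add_zero]
  · rw [hQc y']
    simp only [hS, hM, mul_zero, tsum_zero, Finset.sum_const_zero, add_zero]

/-- NOT IN PRINT; OUR BOOKKEEPING.  **SAME DIRECTION: (M0) ∧ (Π) FOR THE σ-PAIR's exit_α⊗exit_α PROFILE, EVERY LEVEL, NO HYPOTHESIS BEYOND THE DEFINING EQUATIONS** (any
in-block root, all `cE cVH cΛ`, every `k y ν α`): `Z_k := Vα − ½·(stepScale_k·Lc^{d+1})⁻¹·Qc` has `Σ' Z_k = 0` and `Σ' (y′ − y)_λ·Z_k(y′) = 0` for every `λ` — the companion of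
`SigmaPairSlotMomentsExit.moments_sigmaPair_exit_of_ward_level` ∕ `…_levelZero` (`α ≠ β`) in the degenerate channel. -/
theorem moments_sigmaPair_exit_same_level (hr : r ∈ box (d + 1) Lc) (cE cVH cΛ : ℝ) (k : ℕ) (y : Site (d + 1)) (ν α : Fin (d + 1))
    {Vα Qc : Site (d + 1) → ℝ}
    (hVα : ∀ y' : Site (d + 1), Vα y' =
        (1 / 2 : ℝ) *
          ((∑ κ : Fin (d + 1), ∑' u : Site (d + 1),
              colH (coDressKBmAt (toSite r) Lc (KInvStep (d := d) Lc k)) Lc ν y' κ u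
                * ((if y' = y then (1 / 2 : ℝ) else 0) - (if blk Lc u = y then (1 / 2 : ℝ) else 0))
                * ∑' xz : Site (d + 1) × Site (d + 1),
                    ((if xz.1 α % (Lc : ℤ) = (Lc : ℤ) - 1 then (1 : ℝ) else 0) * (if xz.2 α % (Lc : ℤ) = (Lc : ℤ) - 1 then (1 : ℝ) else 0))
                      * SpureRecAt d Lc (toSite r) cE cVH cΛ k κ u xz.1 xz.2 (Sum.inl α) (Sum.inl α))
            + ∑ ρ' : Fin (d + 1), ∑' w : Site (d + 1),
              colM (coDressKBmAt (toSite r) Lc (KInvStep (d := d) Lc k)) Lc ν y' ρ' w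
                * ((if y' = y then (1 / 2 : ℝ) else 0) - (if w = y then (1 / 2 : ℝ) else 0))
                * ∑' xz : Site (d + 1) × Site (d + 1),
                    ((if xz.1 α % (Lc : ℤ) = (Lc : ℤ) - 1 then (1 : ℝ) else 0) * (if xz.2 α % (Lc : ℤ) = (Lc : ℤ) - 1 then (1 : ℝ) else 0))
                      * M1At d Lc (toSite r) cΛ k ρ' w xz.1 xz.2 (Sum.inl α) (Sum.inl α)))
    (hQc : ∀ y' : Site (d + 1), Qc y' =
        (∑ κ : Fin (d + 1), ∑' u : Site (d + 1),
            (∑' x₂, ∑ κ₂, comp (coDressKBmAt (toSite r) Lc (KInvStep (d := d) Lc k))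
                (dM (coDressKBmAt (toSite r) Lc (KInvStep (d := d) Lc k)) Lc (SpureRecAt d Lc (toSite r) cE cVH cΛ k) (M1At d Lc (toSite r) cΛ k) ν y')
                u x₂ (Sum.inl κ) (Sum.inl κ₂) * gaugeWt Lc y κ₂ x₂)
              * ∑' xz : Site (d + 1) × Site (d + 1),
                  ((if xz.1 α % (Lc : ℤ) = (Lc : ℤ) - 1 then (1 : ℝ) else 0) * (if xz.2 α % (Lc : ℤ) = (Lc : ℤ) - 1 then (1 : ℝ) else 0))
                    * SpureRecAt d Lc (toSite r) cE cVH cΛ k κ u xz.1 xz.2 (Sum.inl α) (Sum.inl α)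
          + ∑ ρ' : Fin (d + 1), ∑' w : Site (d + 1),
            (∑' x₂, ∑ κ₂, comp (coDressKBmAt (toSite r) Lc (KInvStep (d := d) Lc k))
                (dM (coDressKBmAt (toSite r) Lc (KInvStep (d := d) Lc k)) Lc (SpureRecAt d Lc (toSite r) cE cVH cΛ k) (M1At d Lc (toSite r) cΛ k) ν y')
                ((Lc : ℤ) • w) x₂ (Sum.inr ρ') (Sum.inl κ₂) * gaugeWt Lc y κ₂ x₂)
              * ∑' xz : Site (d + 1) × Site (d + 1),
                  ((if xz.1 α % (Lc : ℤ) = (Lc : ℤ) - 1 then (1 : ℝ) else 0) * (if xz.2 α % (Lc : ℤ) = (Lc : ℤ) - 1 then (1 : ℝ) else 0))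
                    * M1At d Lc (toSite r) cΛ k ρ' w xz.1 xz.2 (Sum.inl α) (Sum.inl α))) :
    (∑' y' : Site (d + 1), (Vα y' - (1 / 2 : ℝ) * (stepScale d Lc k * (Lc : ℝ) ^ (d + 1))⁻¹ * Qc y') = 0)
      ∧ ∀ lam : Fin (d + 1),
        ∑' y' : Site (d + 1), (((y' - y) lam : ℤ) : ℝ) * (Vα y' - (1 / 2 : ℝ) * (stepScale d Lc k * (Lc : ℝ) ^ (d + 1))⁻¹ * Qc y') = 0 := by
  have h := profiles_sigmaPair_exit_same_eq_zero_level hr cE cVH cΛ k y ν α hVα hQc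
  have hZ : ∀ y', Vα y' - (1 / 2 : ℝ) * (stepScale d Lc k * (Lc : ℝ) ^ (d + 1))⁻¹ * Qc y' = 0 := fun y' => by
    rw [(h y').1, (h y').2]; ring
  refine ⟨?_, fun lam => ?_⟩
  · simp only [hZ, tsum_zero]
  · simp only [hZ, mul_zero, tsum_zero]

end Summit.QuantumFields.BalabanUV.Beta.GAN24.SigmaPairSlotMomentsExitSame

end
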